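import Literature.Analysis.TotalPositivity.PolyaFrequencyFunctionsProofs
import Literature.Analysis.TotalPositivity.PolyaFrequencyConvolution
import Literature.Analysis.TotalPositivity.PolyaFrequencyGaussian
import HarnessLib

/-!
# Pólya frequency functions with finitely many exponential factors (Schoenberg 1951,
sufficiency half, finite case)

Trunk `Literature/Analysis/TotalPositivity`, fourth proofs file accompanying
`PolyaFrequencyFunctions.lean` (the named fact `schoenberg1951_pf_laplace`).  Assembling the
building blocks of `PolyaFrequencyFunctionsProofs.lean` (one-sided exponentials, affine
closure), `PolyaFrequencyConvolution.lean` (Schoenberg's Lemma 1: closure under convolution,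
multiplicativity of the transform) and `PolyaFrequencyGaussian.lean` (the normal frequency
function) we obtain the sufficiency half of Schoenberg's theorem for the entire functions (7)
with FINITELY many factors:

> for `Ψ(s) = C e^{−γs² + δs} ∏_{ν<N} (1 + d_ν s) e^{−d_ν s}` (`C > 0`, `γ ≥ 0`, `δ, d_ν ∈ ℝ`,
> `0 < γ + Σ d_ν²`) there is a Pólya frequency function `Λ` — "obtained by convoluting the normal
> function with a finite sequence of one-sided exponentials" [SchoenbergWhitney1953, p. 247] —
> whose bilateral Laplace transform converges absolutely on the strip `|Re s| < ρ` (any `ρ > 0`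
> with `ρ |d_ν| ≤ 1` for all `ν`) and equals `1/Ψ(s)` there

(`exists_pf_finiteProduct`, by induction on `N`, carrying a sup bound for the next convolution;
`exists_pf_finiteProduct_gauss`, the case `γ > 0` with `Λ` moreover continuous — the input of the
passage `N → ∞`; `exists_pf_of_schoenbergForm_finite`, the tree's `∏'`-form of (7) with finitely
supported `d_ν`).  The passage `N → ∞` and the necessity half are not in this file.

## References

* I. J. Schoenberg, *On Pólya frequency functions. I*, J. Analyse Math. 1 (1951) 331–374,
  Lemma 1, §1 and Thm. 1 (sufficiency). [Schoenberg1951]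
* I. J. Schoenberg, A. Whitney, *On Pólya frequency functions. III*, Trans. AMS 74 (1953),
  Introduction, pp. 246–247, (3)–(7). [SchoenbergWhitney1953]
* S. Karlin, *Total Positivity* I (1968), Ch. 7, §§1–2. [Karlin1968]
-/

noncomputable section

open MeasureTheory Set
open scoped Topology

namespace Literature.Analysis.TotalPositivity

/-! ### Bounds for the building blocks -/

/-- `E(v) = e^{−v} 1_{v ≥ 0} ≤ 1`. [folklore] -/
theorem expIndicator_le_one (v : ℝ) :
    (Set.Ici (0 : ℝ)).indicator (fun u => Real.exp (-u)) v ≤ 1 := by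
  by_cases hv : v ∈ Set.Ici (0 : ℝ)
  · rw [Set.indicator_of_mem hv]
    exact Real.exp_le_one_iff.2 (by simpa using hv)
  · rw [Set.indicator_of_notMem hv]
    exact zero_le_one

/-- The one-sided exponential of variance `δ²` is bounded by `|δ|⁻¹`. [folklore] -/
theorem oneSidedExp_le {δ : ℝ} (u : ℝ) :
    |δ|⁻¹ * (Set.Ici (0 : ℝ)).indicator (fun u => Real.exp (-u)) (u / δ + 1) ≤ |δ|⁻¹ :=
  mul_le_of_le_one_right (inv_nonneg.2 (abs_nonneg δ)) (expIndicator_le_one _)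

/-! ### Continuity of a convolution with a continuous bounded factor -/

/-- The convolution `u ↦ ∫ Λ(t) L(u − t) dt` of a continuous, bounded, non-negative `Λ` with an
integrable `L` is continuous (write it as `∫ L(t) Λ(u − t) dt` and dominate). [folklore] -/
theorem continuous_conv_of_continuous_left {Λ L : ℝ → ℝ} (hΛc : Continuous Λ)
    (hΛ0 : ∀ u, 0 ≤ Λ u) {B : ℝ} (hΛB : ∀ u, Λ u ≤ B) (hL : Integrable L) :
    Continuous fun u => ∫ t, Λ t * L (u - t) := by
  have hswap : (fun u => ∫ t, Λ t * L (u - t)) =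
      MeasureTheory.convolution L Λ (ContinuousLinearMap.mul ℝ ℝ) volume := by
    funext u
    rw [MeasureTheory.convolution_def, ← integral_sub_left_eq_self _ volume u]
    congr 1
    funext t
    simp only [ContinuousLinearMap.mul_apply', sub_sub_cancel]
    ring
  rw [hswap]
  refine BddAbove.continuous_convolution_right_of_integrable (ContinuousLinearMap.mul ℝ ℝ)
    ⟨B, ?_⟩ hL hΛc
  rintro _ ⟨u, rfl⟩
  simpa [Real.norm_eq_abs, abs_of_nonneg (hΛ0 u)] using hΛB u

/-! ### The convolution step -/

/-- **One more exponential factor.**  If `Λ` is a bounded Pólya frequency function with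
reciprocal transform `Ψ` on `|Re s| < ρ`, and `d ≠ 0` with `ρ ≤ |d|⁻¹`, then
`Λ ⋆ Λ_d` is a bounded Pólya frequency function with reciprocal transform
`Ψ(s) (1 + ds) e^{−ds}` on the same strip; it is continuous if `Λ` is.
[cite: Schoenberg1951, Lemma 1] [cite: SchoenbergWhitney1953, Introduction (5)–(7)] -/
theorem exists_pf_convStep {Λ : ℝ → ℝ} {Ψ : ℂ → ℂ} {ρ : ℝ} (hΛ : IsPolyaFrequencyFun Λ)
    {B : ℝ} (hB : ∀ u, Λ u ≤ B) (hΨ : HasLaplaceTransformInvOn Λ Ψ (-ρ) ρ) {d : ℝ} (hd : d ≠ 0)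
    (hρd : ρ ≤ |d|⁻¹) :
    ∃ Λ' : ℝ → ℝ, IsPolyaFrequencyFun Λ' ∧ (∃ B', ∀ u, Λ' u ≤ B') ∧
      HasLaplaceTransformInvOn Λ'
        (fun s => Ψ s * ((1 + (d : ℂ) * s) * Complex.exp (-((d : ℂ) * s)))) (-ρ) ρ ∧
      (Continuous Λ → Continuous Λ') := by
  set L : ℝ → ℝ := fun u =>
    |d|⁻¹ * (Set.Ici (0 : ℝ)).indicator (fun u => Real.exp (-u)) (u / d + 1) with hL_def
  have hL : IsPolyaFrequencyFun L := isPolyaFrequencyFun_oneSidedExp hd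
  have hLt : HasLaplaceTransformInvOn L
      (fun s => (1 + (d : ℂ) * s) * Complex.exp (-((d : ℂ) * s))) (-ρ) ρ :=
    hasLaplaceTransformInvOn_oneSidedExp hd hρd
  have hLb : ∀ u, L u ≤ |d|⁻¹ := fun u => oneSidedExp_le u
  refine ⟨fun u => ∫ t, Λ t * L (u - t), hΛ.conv hL hLb,
    ⟨|d|⁻¹ * ∫ t, Λ t, fun u => conv_le_of_le hΛ hL.nonneg hLb u⟩, hΨ.conv hLt, fun hc => ?_⟩
  exact continuous_conv_of_continuous_left hc hΛ.nonneg hB hL.integrable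

/-! ### The two ways to start: a single exponential, or the Gaussian -/

/-- **A single exponential factor**: for `C > 0`, `δ ∈ ℝ`, `d ≠ 0` the bounded Pólya frequency
function `C⁻¹ Λ_d(x − δ)` has reciprocal Laplace transform `C e^{δs} (1 + ds) e^{−ds}` on the
strip `|Re s| < ρ`, `ρ ≤ |d|⁻¹`. [cite: SchoenbergWhitney1953, Introduction (5)] -/
theorem exists_pf_expStart {C : ℝ} (hC : 0 < C) (δ : ℝ) {d : ℝ} (hd : d ≠ 0) {ρ : ℝ}
    (hρd : ρ ≤ |d|⁻¹) :
    ∃ Λ : ℝ → ℝ, IsPolyaFrequencyFun Λ ∧ (∃ B, ∀ u, Λ u ≤ B) ∧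
      HasLaplaceTransformInvOn Λ (fun s => (C : ℂ) * Complex.exp ((δ : ℂ) * s) *
        ((1 + (d : ℂ) * s) * Complex.exp (-((d : ℂ) * s)))) (-ρ) ρ := by
  set L : ℝ → ℝ := fun u =>
    |d|⁻¹ * (Set.Ici (0 : ℝ)).indicator (fun u => Real.exp (-u)) (u / d + 1) with hL_def
  have hL : IsPolyaFrequencyFun L := isPolyaFrequencyFun_oneSidedExp hd
  have hLt : HasLaplaceTransformInvOn L
      (fun s => (1 + (d : ℂ) * s) * Complex.exp (-((d : ℂ) * s))) (-ρ) ρ :=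
    hasLaplaceTransformInvOn_oneSidedExp hd hρd
  refine ⟨fun u => C⁻¹ * L (u + -δ), (hL.comp_add (-δ)).const_mul (inv_pos.2 hC),
    ⟨C⁻¹ * |d|⁻¹, fun u => ?_⟩, ?_⟩
  · exact mul_le_mul_of_nonneg_left (oneSidedExp_le _) (inv_nonneg.2 hC.le)
  · refine ((hLt.comp_add (-δ)).const_mul (inv_ne_zero hC.ne')).congr rfl fun s _ _ => ?_
    push_cast
    rw [inv_inv]
    ring_nf

/-- **The Gaussian factor**: for `C > 0`, `γ > 0`, `δ ∈ ℝ` a positive multiple of the shifted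
normal frequency function `e^{−(x−δ)²/(4γ)}` is a continuous bounded Pólya frequency function
with reciprocal Laplace transform `C e^{−γs² + δs}` on every strip `|Re s| < ρ`.
[cite: SchoenbergWhitney1953, Introduction (3)] -/
theorem exists_pf_gaussStart {C γ : ℝ} (hC : 0 < C) (hγ : 0 < γ) (δ ρ : ℝ) :
    ∃ Λ : ℝ → ℝ, IsPolyaFrequencyFun Λ ∧ (∃ B, ∀ u, Λ u ≤ B) ∧
      HasLaplaceTransformInvOn Λ
        (fun s => (C : ℂ) * Complex.exp (-(γ : ℂ) * s ^ 2 + (δ : ℂ) * s)) (-ρ) ρ ∧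
      Continuous Λ := by
  set a : ℝ := (4 * γ)⁻¹ with ha_def
  have ha : 0 < a := by positivity
  set κ : ℝ := (Real.sqrt (Real.pi / a))⁻¹ with hκ_def
  have hκ : 0 < κ := inv_pos.2 (Real.sqrt_pos.2 (div_pos Real.pi_pos ha))
  set G : ℝ → ℝ := fun u => Real.exp (-a * u ^ 2) with hG_def
  have hG : IsPolyaFrequencyFun G := by
    simpa [hG_def] using isPolyaFrequencyFun_gaussian ha one_pos
  have hGt : HasLaplaceTransformInvOn G (fun s => (κ : ℂ) * Complex.exp (-(s ^ 2 / (4 * a))))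
      (-ρ) ρ := hasLaplaceTransformInvOn_gaussian ha (-ρ) ρ
  set k : ℝ := κ / C with hk_def
  have hk : 0 < k := div_pos hκ hC
  refine ⟨fun u => k * G (u + -δ), (hG.comp_add (-δ)).const_mul hk, ⟨k, fun u => ?_⟩, ?_, ?_⟩
  · refine mul_le_of_le_one_right hk.le (Real.exp_le_one_iff.2 ?_)
    nlinarith [sq_nonneg (u + -δ)]
  · refine ((hGt.comp_add (-δ)).const_mul hk.ne').congr rfl fun s _ _ => ?_
    have hκC : (κ : ℂ) ≠ 0 := Complex.ofReal_ne_zero.2 hκ.ne'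
    have hCC : (C : ℂ) ≠ 0 := Complex.ofReal_ne_zero.2 hC.ne'
    have hγC : (γ : ℂ) ≠ 0 := Complex.ofReal_ne_zero.2 hγ.ne'
    have h4a : s ^ 2 / (4 * (a : ℂ)) = (γ : ℂ) * s ^ 2 := by
      rw [ha_def]
      push_cast
      field_simp
    rw [h4a, hk_def, Complex.exp_add]
    push_cast
    field_simp
  · exact continuous_const.mul (Real.continuous_exp.comp (continuous_const.mul
      ((continuous_id.add continuous_const).pow 2)))

/-! ### Finitely many factors -/

/-- **Sufficiency half of Schoenberg's theorem, finitely many factors** (Schoenberg 1951,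
Thm. 1 for the functions (7) with `δ_ν = 0` for `ν ≥ N`): for `C > 0`, `γ ≥ 0`, `δ, d_ν ∈ ℝ`
with `0 < γ + Σ_{ν<N} d_ν²`, and any `ρ > 0` with `ρ |d_ν| ≤ 1` (`ν < N`), there is a bounded
Pólya frequency function whose bilateral Laplace transform converges absolutely on
`|Re s| < ρ` to `1 / (C e^{−γs²+δs} ∏_{ν<N} (1 + d_ν s) e^{−d_ν s})`.  Induction on `N`: start
from the Gaussian (`γ > 0`) or from the first non-zero exponential factor (`γ = 0`), and
convolve with one more one-sided exponential `Λ_{d_N}` at each step.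
[cite: Schoenberg1951, Thm. 1 (sufficiency), Lemma 1]
[cite: SchoenbergWhitney1953, Introduction pp. 246–247, (3)–(7)] -/
theorem exists_pf_finiteProduct {C γ : ℝ} (hC : 0 < C) (hγ : 0 ≤ γ) (δ : ℝ) (d : ℕ → ℝ) {ρ : ℝ}
    (hρ : 0 < ρ) (hρd : ∀ ν, ρ * |d ν| ≤ 1) :
    ∀ N : ℕ, 0 < γ + ∑ ν ∈ Finset.range N, d ν ^ 2 →
      ∃ Λ : ℝ → ℝ, IsPolyaFrequencyFun Λ ∧ (∃ B, ∀ u, Λ u ≤ B) ∧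
        HasLaplaceTransformInvOn Λ (fun s => (C : ℂ) *
          Complex.exp (-(γ : ℂ) * s ^ 2 + (δ : ℂ) * s) *
            ∏ ν ∈ Finset.range N, ((1 + (d ν : ℂ) * s) * Complex.exp (-((d ν : ℂ) * s))))
          (-ρ) ρ := by
  have hρd' : ∀ ν, d ν ≠ 0 → ρ ≤ |d ν|⁻¹ := fun ν hν => by
    have ha : 0 < |d ν| := abs_pos.2 hν
    calc ρ = ρ * |d ν| / |d ν| := by field_simp
      _ ≤ 1 / |d ν| := div_le_div_of_nonneg_right (hρd ν) ha.le
      _ = |d ν|⁻¹ := one_div _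
  intro N
  induction N with
  | zero =>
    intro hpos
    simp only [Finset.range_zero, Finset.sum_empty, add_zero] at hpos
    obtain ⟨Λ, hΛ, hB, hΨ, -⟩ := exists_pf_gaussStart hC hpos δ ρ
    exact ⟨Λ, hΛ, hB, hΨ.congr rfl fun s _ _ => by simp⟩
  | succ N ih =>
    intro hpos
    by_cases hprev : 0 < γ + ∑ ν ∈ Finset.range N, d ν ^ 2
    · obtain ⟨Λ, hΛ, ⟨B, hB⟩, hΨ⟩ := ih hprev
      by_cases hdN : d N = 0
      · refine ⟨Λ, hΛ, ⟨B, hB⟩, hΨ.congr rfl fun s _ _ => ?_⟩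
        rw [Finset.prod_range_succ, hdN]
        simp
      · obtain ⟨Λ', hΛ', hB', hΨ', -⟩ := exists_pf_convStep hΛ hB hΨ hdN (hρd' N hdN)
        refine ⟨Λ', hΛ', hB', hΨ'.congr rfl fun s _ _ => ?_⟩
        rw [Finset.prod_range_succ]
        ring
    · -- `γ = 0`, `d ν = 0` for `ν < N`, hence `d N ≠ 0`: start here
      have hnn : 0 ≤ ∑ ν ∈ Finset.range N, d ν ^ 2 := Finset.sum_nonneg fun ν _ => sq_nonneg _
      have hzero : γ + ∑ ν ∈ Finset.range N, d ν ^ 2 = 0 :=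
        le_antisymm (not_lt.1 hprev) (add_nonneg hγ hnn)
      have hγ0 : γ = 0 := by linarith
      have hsum0 : ∑ ν ∈ Finset.range N, d ν ^ 2 = 0 := by linarith
      have hdν : ∀ ν ∈ Finset.range N, d ν = 0 := fun ν hν => by
        have := (Finset.sum_eq_zero_iff_of_nonneg (fun ν _ => sq_nonneg (d ν))).1 hsum0 ν hν
        exact pow_eq_zero_iff two_ne_zero |>.1 this
      have hdN : d N ≠ 0 := by
        intro h0
        rw [Finset.sum_range_succ, h0, hsum0, hγ0] at hpos
        norm_num at hpos
      obtain ⟨Λ, hΛ, hB, hΨ⟩ := exists_pf_expStart hC δ hdN (hρd' N hdN)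
      refine ⟨Λ, hΛ, hB, hΨ.congr rfl fun s _ _ => ?_⟩
      rw [Finset.prod_range_succ, Finset.prod_eq_one (fun ν hν => by rw [hdν ν hν]; simp), hγ0]
      simp

/-- **The case `γ > 0`, with continuity**: for `C > 0`, `γ > 0`, `δ, d_ν ∈ ℝ`, `ρ > 0` with
`ρ|d_ν| ≤ 1`, and every `N`, there is a CONTINUOUS bounded Pólya frequency function (the
Gaussian convolved with the `Λ_{d_ν}`, `ν < N`, `d_ν ≠ 0`) with reciprocal Laplace transform
`C e^{−γs²+δs} ∏_{ν<N} (1 + d_ν s) e^{−d_ν s}` on `|Re s| < ρ`.  This is the family whose limit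
`N → ∞` realises the general function (7). [cite: Schoenberg1951, Thm. 1 (sufficiency)]
[cite: SchoenbergWhitney1953, Introduction pp. 246–247] -/
theorem exists_pf_finiteProduct_gauss {C γ : ℝ} (hC : 0 < C) (hγ : 0 < γ) (δ : ℝ) (d : ℕ → ℝ)
    {ρ : ℝ} (hρ : 0 < ρ) (hρd : ∀ ν, ρ * |d ν| ≤ 1) (N : ℕ) :
    ∃ Λ : ℝ → ℝ, IsPolyaFrequencyFun Λ ∧ (∃ B, ∀ u, Λ u ≤ B) ∧
      HasLaplaceTransformInvOn Λ (fun s => (C : ℂ) *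
        Complex.exp (-(γ : ℂ) * s ^ 2 + (δ : ℂ) * s) *
          ∏ ν ∈ Finset.range N, ((1 + (d ν : ℂ) * s) * Complex.exp (-((d ν : ℂ) * s))))
        (-ρ) ρ ∧ Continuous Λ := by
  have hρd' : ∀ ν, d ν ≠ 0 → ρ ≤ |d ν|⁻¹ := fun ν hν => by
    have ha : 0 < |d ν| := abs_pos.2 hν
    calc ρ = ρ * |d ν| / |d ν| := by field_simp
      _ ≤ 1 / |d ν| := div_le_div_of_nonneg_right (hρd ν) ha.le
      _ = |d ν|⁻¹ := one_div _
  induction N with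
  | zero =>
    obtain ⟨Λ, hΛ, hB, hΨ, hc⟩ := exists_pf_gaussStart hC hγ δ ρ
    exact ⟨Λ, hΛ, hB, hΨ.congr rfl fun s _ _ => by simp, hc⟩
  | succ N ih =>
    obtain ⟨Λ, hΛ, ⟨B, hB⟩, hΨ, hc⟩ := ih
    by_cases hdN : d N = 0
    · refine ⟨Λ, hΛ, ⟨B, hB⟩, hΨ.congr rfl fun s _ _ => ?_, hc⟩
      rw [Finset.prod_range_succ, hdN]
      simp
    · obtain ⟨Λ', hΛ', hB', hΨ', hc'⟩ := exists_pf_convStep hΛ hB hΨ hdN (hρd' N hdN)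
      refine ⟨Λ', hΛ', hB', hΨ'.congr rfl fun s _ _ => ?_, hc' hc⟩
      rw [Finset.prod_range_succ]
      ring

/-- A square-summable real sequence admits `ρ > 0` with `ρ |d_ν| ≤ 1` for all `ν` (it is
bounded). [folklore] -/
theorem exists_rho_of_summable_sq {d : ℕ → ℝ} (hd : Summable fun ν => d ν ^ 2) :
    ∃ ρ : ℝ, 0 < ρ ∧ ∀ ν, ρ * |d ν| ≤ 1 := by
  have h0 := hd.tendsto_atTop_zero
  obtain ⟨M, hM⟩ : ∃ M, ∀ ν, d ν ^ 2 ≤ M := by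
    obtain ⟨M, hM⟩ := (h0.bddAbove_range)
    exact ⟨M, fun ν => hM ⟨ν, rfl⟩⟩
  have hM0 : 0 ≤ M := (sq_nonneg (d 0)).trans (hM 0)
  refine ⟨(Real.sqrt M + 1)⁻¹, by positivity, fun ν => ?_⟩
  rw [inv_mul_le_iff₀ (by positivity), mul_one]
  have : |d ν| ≤ Real.sqrt M := by
    rw [← Real.sqrt_sq_eq_abs]
    exact Real.sqrt_le_sqrt (hM ν)
  linarith

/-- **Sufficiency half of Schoenberg's theorem for the form (7) with finitely supported `δ_ν`**
(the tree's `∏'`-rendering `HasSchoenbergForm` restricted to `δ_ν = 0` for `ν ≥ N`): such a `Ψ`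
is `1/(Laplace transform)` of some Pólya frequency function on a strip about the imaginary axis.
[cite: Schoenberg1951, Thm. 1 (sufficiency)]
[cite: SchoenbergWhitney1953, Introduction pp. 246–247, (6)–(7)] -/
theorem exists_pf_of_schoenbergForm_finite {Ψ : ℂ → ℂ} {C γ δ : ℝ} {d : ℕ → ℝ} {N : ℕ}
    (hC : 0 < C) (hγ : 0 ≤ γ) (hd : ∀ ν, N ≤ ν → d ν = 0) (hpos : 0 < γ + ∑' ν, d ν ^ 2)
    (hΨ : ∀ s : ℂ, Ψ s = (C : ℂ) * Complex.exp (-(γ : ℂ) * s ^ 2 + (δ : ℂ) * s) *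
        ∏' ν, (1 + (d ν : ℂ) * s) * Complex.exp (-((d ν : ℂ) * s))) :
    ∃ (Λ : ℝ → ℝ) (a b : ℝ), a < 0 ∧ 0 < b ∧ IsPolyaFrequencyFun Λ ∧
      HasLaplaceTransformInvOn Λ Ψ a b := by
  have hfin : ∀ ν ∉ Finset.range N, d ν = 0 := fun ν hν => hd ν (by simpa using hν)
  have hsum : ∑' ν, d ν ^ 2 = ∑ ν ∈ Finset.range N, d ν ^ 2 :=
    tsum_eq_sum fun ν hν => by
      rw [hfin ν hν]
      simp
  have hprod : ∀ s : ℂ, ∏' ν, (1 + (d ν : ℂ) * s) * Complex.exp (-((d ν : ℂ) * s)) =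
      ∏ ν ∈ Finset.range N, (1 + (d ν : ℂ) * s) * Complex.exp (-((d ν : ℂ) * s)) := fun s =>
    tprod_eq_prod fun ν hν => by
      rw [hfin ν hν]
      simp
  have hsumm : Summable fun ν => d ν ^ 2 :=
    summable_of_ne_finset_zero (s := Finset.range N) fun ν hν => by
      rw [hfin ν hν]
      simp
  obtain ⟨ρ, hρ, hρd⟩ := exists_rho_of_summable_sq hsumm
  rw [hsum] at hpos
  obtain ⟨Λ, hΛ, _, hΨ'⟩ := exists_pf_finiteProduct hC hγ δ d hρ hρd N hpos
  exact ⟨Λ, -ρ, ρ, by linarith, hρ, hΛ, hΨ'.congr rfl fun s _ _ => by rw [hΨ s, hprod s]⟩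

end Literature.Analysis.TotalPositivity

end
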